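import Summits.AtomisticToContinuum.Crystallization.Theorems.PerronTransitivityUniformBindingRigidityCohesionN

/-!
# Cohesion of uniformly bound Lennard-Jones configurations, XVII: the separation rung `31/50`

Helper file (`--supports stmt-AtomisticToContinuum-15099`) proving the registered stub
`stub_sepThirtyOne` (= `(SEP³¹)`, skeleton `Lines/birth.lean` rev 6) of the line `registered` of the
crux `Summit.AtomisticToContinuum.Crystallization.Theses.PerronTransitivity.UniformBindingRigidity`
(item stmt-AtomisticToContinuum-15099).  Notation `U_Y(p) = Σ'_{q ∈ Y, q ≠ p} V_LJ(dist p q)`,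
`T(δ, R) = 16/(δ³R³) + 18/(δ²R⁴) + 36/(5δR⁵) + 1/R⁶` (the sharp tail of parts XIII–XIV).

The separation ladder `1/4 → 9/20 → 23/40` (`stub_sepBootstrap`, `sepSharp`, composite
`sep_of_quarter_sharp`, parts X/XV) is extended by one rung: the infimum-of-distances argument of
part XV verbatim, with the pair-selection constant `2^{1/12}` replaced by `(11/10)^{1/12}` (so the
distinguished pair has `(dist a b)⁻¹² > ((11/10) m¹²)⁻¹` instead of `(2m¹²)⁻¹`), runs from `23/40`
up to `31/50`:

* §30 the endpoint numerics `sepThirtyOne_numerics` on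
  `[23/40, 3/5] ∪ [3/5, 123/200] ∪ [123/200, 31/50]` (margins `> 7, 2, 1.5`);
* §31 `stub_sepThirtyOne` — a `23/40`-separated `Y ⊆ ℝ³` all of whose site sums are `≤ −711/500`
  is `31/50`-separated — and the composite from `1/4`, `sep_of_quarter_thirtyOne`.

All `[folklore]`.
-/

noncomputable section

namespace Summit.AtomisticToContinuum.Crystallization.Theorems.PerronTransitivityUniformBindingRigidity

open scoped BigOperators Topology
open Filter Set Metric
open Literature.MathematicalPhysics.StatisticalMechanics
open Summit.AtomisticToContinuum.Crystallization.Theorems.ChargedEnergyGapNegative (E3)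

/-! ## §30 Numerics of the rung `23/40 → 31/50` -/

/-- **Numerics of the rung `31/50`.** For `23/40 ≤ m ≤ 31/50`:
`m⁻⁶/6 + ((13/5)/m + 1)³ − 2)/12 + T(m, 13/10)/6 − 711/500 < (1/12)((11/10) m¹²)⁻¹`
(three cases; every term is monotone in `m` and is bounded at the unfavourable endpoint of its
interval). [folklore] -/
theorem sepThirtyOne_numerics {m : ℝ} (h1 : 23 / 40 ≤ m) (h2 : m ≤ 31 / 50) :
    1 / 6 * m⁻¹ ^ 6 + 1 / 12 * ((2 * (13 / 10) / m + 1) ^ 3 - 2) +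
        1 / 6 * (16 / (m ^ 3 * (13 / 10) ^ 3) + 18 / (m ^ 2 * (13 / 10) ^ 4) +
          36 / (5 * m * (13 / 10) ^ 5) + 1 / (13 / 10 : ℝ) ^ 6) - 711 / 500 <
      1 / 12 * ((11 / 10) * m ^ 12)⁻¹ := by
  have hm0 : 0 < m := by linarith
  have h13 : (0 : ℝ) < 13 / 10 := by norm_num
  rcases le_total m (3 / 5) with h | h
  · -- `23/40 ≤ m ≤ 3/5`
    have hA : (1 : ℝ) / 12 * ((11 / 10) * (3 / 5 : ℝ) ^ 12)⁻¹ ≤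
        1 / 12 * ((11 / 10) * m ^ 12)⁻¹ := by
      gcongr
    have hA' : (348 / 10 : ℝ) ≤ 1 / 12 * ((11 / 10) * (3 / 5 : ℝ) ^ 12)⁻¹ := by norm_num
    have hB : m⁻¹ ^ 6 ≤ (23 / 40 : ℝ)⁻¹ ^ 6 := by gcongr
    have hB' : (23 / 40 : ℝ)⁻¹ ^ 6 ≤ 277 / 10 := by norm_num
    have hC : (2 * (13 / 10) / m + 1) ^ 3 ≤ (2 * (13 / 10) / (23 / 40 : ℝ) + 1) ^ 3 := by gcongr
    have hC' : (2 * (13 / 10) / (23 / 40 : ℝ) + 1) ^ 3 ≤ 1684 / 10 := by norm_num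
    have hD := sharpTail_anti (by norm_num : (0 : ℝ) < 23 / 40) h1 h13
    have hD' : 16 / ((23 / 40 : ℝ) ^ 3 * (13 / 10) ^ 3) + 18 / ((23 / 40 : ℝ) ^ 2 * (13 / 10) ^ 4) +
        36 / (5 * (23 / 40 : ℝ) * (13 / 10) ^ 5) + 1 / (13 / 10 : ℝ) ^ 6 ≤ 61 := by norm_num
    linarith
  rcases le_total m (123 / 200) with h' | h'
  · -- `3/5 ≤ m ≤ 123/200`
    have hA : (1 : ℝ) / 12 * ((11 / 10) * (123 / 200 : ℝ) ^ 12)⁻¹ ≤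
        1 / 12 * ((11 / 10) * m ^ 12)⁻¹ := by
      gcongr
    have hA' : (2587 / 100 : ℝ) ≤ 1 / 12 * ((11 / 10) * (123 / 200 : ℝ) ^ 12)⁻¹ := by norm_num
    have hB : m⁻¹ ^ 6 ≤ (3 / 5 : ℝ)⁻¹ ^ 6 := by gcongr
    have hB' : (3 / 5 : ℝ)⁻¹ ^ 6 ≤ 2144 / 100 := by norm_num
    have hC : (2 * (13 / 10) / m + 1) ^ 3 ≤ (2 * (13 / 10) / (3 / 5 : ℝ) + 1) ^ 3 := by gcongr
    have hC' : (2 * (13 / 10) / (3 / 5 : ℝ) + 1) ^ 3 ≤ 15171 / 100 := by norm_num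
    have hD := sharpTail_anti (by norm_num : (0 : ℝ) < 3 / 5) h h13
    have hD' : 16 / ((3 / 5 : ℝ) ^ 3 * (13 / 10) ^ 3) + 18 / ((3 / 5 : ℝ) ^ 2 * (13 / 10) ^ 4) +
        36 / (5 * (3 / 5 : ℝ) * (13 / 10) ^ 5) + 1 / (13 / 10 : ℝ) ^ 6 ≤ 5467 / 100 := by norm_num
    linarith
  · -- `123/200 ≤ m ≤ 31/50`
    have hA : (1 : ℝ) / 12 * ((11 / 10) * (31 / 50 : ℝ) ^ 12)⁻¹ ≤
        1 / 12 * ((11 / 10) * m ^ 12)⁻¹ := by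
      gcongr
    have hA' : (2348 / 100 : ℝ) ≤ 1 / 12 * ((11 / 10) * (31 / 50 : ℝ) ^ 12)⁻¹ := by norm_num
    have hB : m⁻¹ ^ 6 ≤ (123 / 200 : ℝ)⁻¹ ^ 6 := by gcongr
    have hB' : (123 / 200 : ℝ)⁻¹ ^ 6 ≤ 1849 / 100 := by norm_num
    have hC : (2 * (13 / 10) / m + 1) ^ 3 ≤ (2 * (13 / 10) / (123 / 200 : ℝ) + 1) ^ 3 := by
      gcongr
    have hC' : (2 * (13 / 10) / (123 / 200 : ℝ) + 1) ^ 3 ≤ 14287 / 100 := by norm_num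
    have hD := sharpTail_anti (by norm_num : (0 : ℝ) < 123 / 200) h' h13
    have hD' : 16 / ((123 / 200 : ℝ) ^ 3 * (13 / 10) ^ 3) +
        18 / ((123 / 200 : ℝ) ^ 2 * (13 / 10) ^ 4) +
        36 / (5 * (123 / 200 : ℝ) * (13 / 10) ^ 5) + 1 / (13 / 10 : ℝ) ^ 6 ≤ 5134 / 100 := by
      norm_num
    linarith

/-! ## §31 The separation rung `23/40 → 31/50` -/

/-- **The rung `31/50` (registered stub `stub_sepThirtyOne`).** A `23/40`-separated `Y ⊆ ℝ³` all of
whose Lennard-Jones site sums are `≤ −711/500` is `31/50`-separated.  With `m = inf` of the mutual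
distances (`23/40 ≤ m < 31/50` if the conclusion failed), `Y` is `m`-separated; at a pair `a ≠ b`
with `dist a b < (11/10)^{1/12} m` (so `(dist a b)⁻¹² > ((11/10) m¹²)⁻¹`, `(dist a b)⁻⁶ ≤ m⁻⁶`,
`dist a b ≤ 13/10`) truncate `U_Y(a)` at radius `13/10` with the sharp tail (part XIV,
`sum_near_sub_sharpTail_le_tsum`): the near sum is `V_LJ(dist a b)` plus at least `−(#F − 1)/12`,
`#F ≤ ((13/5)/m + 1)³ − 1` (`card_near_le`), the tail is `≥ −T(m, 13/10)/6`, and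
`sepThirtyOne_numerics` contradicts `U_Y(a) ≤ −711/500`. [folklore] -/
theorem stub_sepThirtyOne :
    ∀ Y : Set (EuclideanSpace ℝ (Fin 3)),
      (∀ p ∈ Y, ∀ q ∈ Y, p ≠ q → 23 / 40 ≤ dist p q) →
      (∀ p ∈ Y, ∑' q : {q : EuclideanSpace ℝ (Fin 3) // q ∈ Y ∧ q ≠ p},
          lennardJones (dist p q.1) ≤ -(711 / 500)) →
      ∀ p ∈ Y, ∀ q ∈ Y, p ≠ q → 31 / 50 ≤ dist p q := by
  classical
  intro Y hsep hU
  by_contra hcon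
  push Not at hcon
  obtain ⟨p₀, hp₀, q₀, hq₀, hne₀, hlt₀⟩ := hcon
  -- the infimum `m` of the mutual distances
  set S : Set ℝ := {r | ∃ a ∈ Y, ∃ b ∈ Y, a ≠ b ∧ r = dist a b} with hS
  have hSne : S.Nonempty := ⟨dist p₀ q₀, p₀, hp₀, q₀, hq₀, hne₀, rfl⟩
  have hSbdd : BddBelow S :=
    ⟨23 / 40, by rintro r ⟨a, ha, b, hb, hab, rfl⟩; exact hsep a ha b hb hab⟩
  set m : ℝ := sInf S with hm
  have h23m : 23 / 40 ≤ m :=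
    le_csInf hSne (by rintro r ⟨a, ha, b, hb, hab, rfl⟩; exact hsep a ha b hb hab)
  have hm0 : 0 < m := by linarith
  have hmsep : ∀ a ∈ Y, ∀ b ∈ Y, a ≠ b → m ≤ dist a b := fun a ha b hb hab =>
    csInf_le hSbdd ⟨a, ha, b, hb, hab, rfl⟩
  have hm31 : m < 31 / 50 := (csInf_le hSbdd ⟨p₀, hp₀, q₀, hq₀, hne₀, rfl⟩).trans_lt hlt₀
  -- a pair at distance `< (11/10)^{1/12} m`
  set c : ℝ := (11 / 10 : ℝ) ^ ((1 : ℝ) / 12) with hc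
  have hc1 : 1 < c := Real.one_lt_rpow (by norm_num) (by norm_num)
  have hc12 : c ^ 12 = 11 / 10 := by
    rw [show (c ^ 12 : ℝ) = c ^ ((12 : ℕ) : ℝ) from (Real.rpow_natCast c 12).symm, hc,
      ← Real.rpow_mul (by norm_num : (0 : ℝ) ≤ 11 / 10)]
    norm_num
  have hmc : m < m * c := lt_mul_right hm0 hc1
  obtain ⟨r, ⟨a, ha, b, hb, hab, rfl⟩, hr⟩ := exists_lt_of_csInf_lt hSne (hm ▸ hmc)
  -- the distinguished distance `dist a b`
  have hdm : m ≤ dist a b := hmsep a ha b hb hab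
  have hd0 : 0 < dist a b := hm0.trans_le hdm
  have hd12 : (dist a b) ^ 12 < 11 / 10 * m ^ 12 := by
    calc (dist a b) ^ 12 < (m * c) ^ 12 := pow_lt_pow_left₀ hr dist_nonneg (by norm_num)
      _ = 11 / 10 * m ^ 12 := by rw [mul_pow, hc12]; ring
  have hinv12 : (11 / 10 * m ^ 12)⁻¹ < (dist a b)⁻¹ ^ 12 := by
    rw [inv_pow]
    exact (inv_lt_inv₀ (by positivity) (by positivity)).2 hd12
  have hinv6 : (dist a b)⁻¹ ^ 6 ≤ m⁻¹ ^ 6 := by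
    gcongr
  have hd13 : dist a b ≤ 13 / 10 := by
    by_contra h
    push Not at h
    have h1 : (13 / 10 : ℝ) ^ 12 ≤ (dist a b) ^ 12 := pow_le_pow_left₀ (by norm_num) h.le 12
    have h2 : m ^ 12 ≤ (31 / 50 : ℝ) ^ 12 := pow_le_pow_left₀ hm0.le hm31.le 12
    norm_num at h1 h2
    linarith
  -- truncation of the site sum at `a` at radius `13/10`, sharp tail
  obtain ⟨F, hF⟩ := exists_finset_near hm0 hmsep a (13 / 10 : ℝ)
  have hlow := sum_near_sub_sharpTail_le_tsum hm0 hmsep a (by norm_num : (0 : ℝ) < 13 / 10) F hF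
  have hcard := card_near_le hm0 hmsep ha (by norm_num : (0 : ℝ) ≤ 13 / 10) F hF
  have hbF : b ∈ F := (hF b).2 ⟨hb, Ne.symm hab, by rw [dist_comm]; exact hd13⟩
  have hsplit : ∑ q ∈ F, lennardJones (dist a q) =
      lennardJones (dist a b) + ∑ q ∈ F.erase b, lennardJones (dist a q) :=
    (Finset.add_sum_erase F (fun q => lennardJones (dist a q)) hbF).symm
  have hrest := neg_card_div_le_sum_lennardJones (F.erase b) fun q => dist a q
  have hcardE : ((F.erase b).card : ℝ) + 1 = F.card := by
    exact_mod_cast Finset.card_erase_add_one hbF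
  have hV : lennardJones (dist a b) =
      1 / 12 * (dist a b)⁻¹ ^ 12 - 1 / 6 * (dist a b)⁻¹ ^ 6 := rfl
  have hnum := sepThirtyOne_numerics h23m hm31.le
  have hUa := hU a ha
  rw [hsplit, hV] at hlow
  linarith

/-- **Composite bootstrap to `31/50`.** A `1/4`-separated `Y ⊆ ℝ³` all of whose Lennard-Jones site
sums are `≤ −711/500` is `31/50`-separated (`sep_of_quarter_sharp` gives `23/40`, then
`stub_sepThirtyOne`). [folklore] -/
theorem sep_of_quarter_thirtyOne {Y : Set E3}
    (hsep : ∀ p ∈ Y, ∀ q ∈ Y, p ≠ q → 1 / 4 ≤ dist p q)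
    (hU : ∀ p ∈ Y, ∑' q : {q : E3 // q ∈ Y ∧ q ≠ p}, lennardJones (dist p q.1) ≤ -(711 / 500)) :
    ∀ p ∈ Y, ∀ q ∈ Y, p ≠ q → 31 / 50 ≤ dist p q :=
  stub_sepThirtyOne Y (sep_of_quarter_sharp hsep hU) hU

end Summit.AtomisticToContinuum.Crystallization.Theorems.PerronTransitivityUniformBindingRigidity

end
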